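import Summits.BirchSwinnertonDyer.BirchSwinnertonDyer.Theorems.ByReductionTypeAtTwoSupersingularFlatBlindLineTransversal
import Summits.BirchSwinnertonDyer.BirchSwinnertonDyer.Theorems.ByReductionTypeAtTwoSupersingularFlatBlindLinePoint
import Summits.BirchSwinnertonDyer.BirchSwinnertonDyer.Theorems.ByReductionTypeAtTwoSupersingularFlatBlindLineClass
import Summits.BirchSwinnertonDyer.BirchSwinnertonDyer.Theorems.ByReductionTypeAtTwoSupersingularFlatLocalZpGen
import Literature.NumberTheory.GaloisRepresentations.LocalGlobalCohomologyFiniteProofs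
import Literature.NumberTheory.EllipticCurves.WeilPairingTateDual
import HarnessLib

/-!
# Route `ByReductionTypeAtTwo` (rung K4), crux `SupersingularRankZeroAtTwo` (item stmt-BirchSwinnertonDyer-19097), line
# `odd_blind_package` (registry v2.10.1), slot 5 `stub_CD` = CDC_H: **HAND h9 = HT-C7locE = (hE) — THE E-SIDE ♭-LINE
# TRANSVERSALITY AT LAYER 1 AND LINE BOUND at `v ∣ 2`, AS TYPED** — the hypothesis `hE` of ★★ p816496
# `OddBlindLocal.lineComplement_of_transversal_of_lineCard` (`…FlatBlindCardPositionLocal.lean` :112–139) is a theorem, with `J₃ = 0`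
# (cell `bsd-2adic`, seat `bsd-2adic-tower-1` GEN 62; pen SUMMON 20260831T085936Z; LEAD ss-1 GEN 21 `HAND-TARGETS-CDC-4.md` ADDENDUM 4b)

HONEST FRAMING: THEOREMS ONLY (no definition, no named fact, no instance, no `sorry`); a helper `--supports 19097` (the hand is a binder of
the CDC_H glue chain ★★ p814705 → ★ p816120 → ★★ p816472 → ★★ p816496, NOT a registered stub); it proves the hand AS TYPED — no print
binder, no `hEP`; it does NOT prove `hloc`'s consumer inputs `hEP`/`hPT`, NOT CDC_H, NOT the crux; nothing is booked (D-0054); BSD is proved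
for no curve by any of this. bears_on: K4 (19097).

## Assembly

* (T) — ★★ p818772 `HTC7locE_flatLine_inf_layerOneKummer_eq_bot` (every `J`): the sharp Honda rung (Kobayashi's blind spot at layer `1`).
* (C) — `HTC7locE_lineCard` (every `J`): the LINE POINT `x_J ∈ E(ℚ_{2J+2,v})` of ★★ p819208 `exists_linePoint` (line polynomials ★ p819010,
  reading lemma ★ p819115) is annihilated by `Ker Col♭` modulo `2^{J+2}`, has `g⁻¹x + x ∈ 2^{J+2}E((ℚ_∞)_w)`, and `z₀(x)` odd for the
  functional `z₀` with `z₀(c_0)` odd (which exists: `c₋, g·c₁` are `𝔽₂`-independent in the tower by ★ `independent_of_nondegeneratePair` on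
  Silverman VII.6.3 at layer `1`, and `c_0 = (a²−2a−1)c₋` with `a` even; Pontryagin separation `exists_addMonoidHom_padicInt_not_dvd`); the
  CLASS OF A POINT ★★ `pow_le_natCard_twistedSharpFlatLocalKummer_of_point` along the local `ℤ₂`-extension of `ℚ_v` with generator `g`
  (`SSFlatEC.exists_localZpExtension_of_isTopGenerator`) and the finiteness of `H¹(ℚ_v, E[2^J](ψ₂))` (Milne ADT I 2.3, tree
  `finite_galoisCohomology_one_adicCompletion`) gives `2^J` distinct classes in `L^E_J`.
* ★★★ `HTC7locE_flatLine_transversal_and_card` — the hand VERBATIM, `J₃ := 0`.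

References: [Kobayashi2003] S. Kobayashi, Invent. math. 152 (2003), §8; [Sprung2012] F. Sprung, J. Number Theory 132 (2012), Thm. 2.2, Def. 5.9,
Def. 7.9 / 7.11; [GreenbergLNM1716] §3–§4; [MilneADT2006] I Cor. 2.3; [SilvermanAEC2009] VII Prop. 6.3.
-/

set_option autoImplicit false
set_option linter.dupNamespace false

noncomputable section

open scoped Classical NumberField

universe u

namespace Summit.BirchSwinnertonDyer.BirchSwinnertonDyer.Theorems

namespace OddBlindLocal

open NumberField IsDedekindDomain Field WeierstrassCurve Literature.NumberTheory.EllipticCurves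
  Literature.NumberTheory.GaloisRepresentations Literature.NumberTheory.GaloisCohomology ZpExtension
  Literature.NumberTheory.EllipticCurves.Kobayashi2003 Literature.NumberTheory.EllipticCurves.Sprung2017
  Literature.NumberTheory.EllipticCurves.Sprung2012 Literature.NumberTheory.EllipticCurves.Rank1Residual
  Summit.BirchSwinnertonDyer.Rank1Residual.F1Sign2

/-- ★★ **Conjunct (C) of the hand (hE) = HT-C7locE, binders VERBATIM, at EVERY level `J`: the LINE BOUND `2^J ≤ #L^E_J`.**
For `W/ℚ` globally minimal with `GoodSS W 2`, `κ` cyclotomic, `v ∋ 2`, local data `(g, c)` carrying a Honda system at two, Sprung's twisted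
♭-condition `L^E_J = twistedSharpFlatLocalFamily 2 κ J (−1) _ v (E((ℚ_∞)_w)) (Ker Col♭) v ≤ H¹(ℚ_v, E[2^J](ψ₂))` has at least `2^J`
elements: the class of the LINE POINT `x_J` (`exists_linePoint`) and its `2^J` distinct multiples
(`pow_le_natCard_twistedSharpFlatLocalKummer_of_point`).  See the module docstring.
[cite: Sprung2012, Thm. 2.2 (p. 1487), Def. 5.9 (p. 1495), Def. 7.9 and Def. 7.11 (p. 1503)] [cite: GreenbergLNM1716, §3 Lemma 3.2, §4 pp. 108, 124]
[cite: MilneADT2006, I Cor. 2.3] [cite: SilvermanAEC2009, VII Prop. 6.3] -/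
theorem HTC7locE_lineCard :
    ∀ (W : WeierstrassCurve ℚ) [W.IsElliptic] [W.IsGloballyMinimal], GoodSS W 2 →
      ∀ (κ : ZpExtension ℚ 2), κ.IsCyclotomic →
      ∀ (v : HeightOneSpectrum (𝓞 ℚ)), (2 : 𝓞 ℚ) ∈ v.asIdeal →
      ∀ (g : Field.absoluteGaloisGroup (v.adicCompletion ℚ)) (c : ℕ → localPoints W (v.adicCompletion ℚ)),
        κ.IsTopGenerator (resGalOfEmb (closureEmb (K := ℚ) (v.adicCompletion ℚ)) g) →
        (∀ n, c n ∈ localLayerPointsOfEmb κ (closureEmb (K := ℚ) (v.adicCompletion ℚ)) W n) →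
        (∀ n, 1 ≤ n → localTraceOfEmb κ (closureEmb (K := ℚ) (v.adicCompletion ℚ)) W n (n + 1)
          (c (n + 1)) = W.frobeniusTrace 2 • c n - c (n - 1)) →
        (∀ z₀ : localLayerPointsOfEmb κ (closureEmb (K := ℚ) (v.adicCompletion ℚ)) W 0 →+ ℤ_[2],
          evalOn W (localLayerPointsOfEmb κ (closureEmb (K := ℚ) (v.adicCompletion ℚ)) W 0) z₀ (c 0) = 0 → z₀ = 0) →
        (∀ a : ℤ_[2],
          (∃ z₀ : localLayerPointsOfEmb κ (closureEmb (K := ℚ) (v.adicCompletion ℚ)) W 0 →+ ℤ_[2],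
            evalOn W (localLayerPointsOfEmb κ (closureEmb (K := ℚ) (v.adicCompletion ℚ)) W 0) z₀ (c 0) = 2 * a) →
          ∃ y : localLayerPointsOfEmb κ (closureEmb (K := ℚ) (v.adicCompletion ℚ)) W 0 →+ ℤ_[2],
            evalOn W (localLayerPointsOfEmb κ (closureEmb (K := ℚ) (v.adicCompletion ℚ)) W 0) y (c 0) = a) →
        (∃ cneg : localPoints W (v.adicCompletion ℚ),
          Summit.BirchSwinnertonDyer.Rank1Residual.F1Sign2.IsHondaSystemAtTwo κ (closureEmb (K := ℚ) (v.adicCompletion ℚ)) W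
            (W.frobeniusTrace 2) g cneg c) →
      ∀ J : ℕ,
        2 ^ J ≤ Nat.card (W.twistedSharpFlatLocalFamily 2 κ J (-1) OddBlindTwist.two_dvd_neg_one_sub_one v
            (localTowerPointsOfEmb κ (closureEmb (K := ℚ) (v.adicCompletion ℚ)) W)
            (colemanKer κ (closureEmb (K := ℚ) (v.adicCompletion ℚ)) W (W.frobeniusTrace 2) g c .flat) v) := by
  intro W _ _ hss κ _hκ v hv g c hg _hc _htr _hz _hsat hH J
  obtain ⟨cneg, hH⟩ := hH
  have hv' : ((2 : ℕ) : 𝓞 ℚ) ∈ v.asIdeal := by exact_mod_cast hv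
  have ha : (2 : ℤ) ∣ W.frobeniusTrace 2 := by exact_mod_cast hss.2
  have ha' : ((2 : ℕ) : ℤ) ∣ W.frobeniusTrace 2 := by exact_mod_cast hss.2
  have hnt := SignedKatoOffTwo.SignedIntersection.noTwoTorsion_localTowerPointsOfEmb_adicCompletion W hss κ v hv
    (closureEmb (K := ℚ) (v.adicCompletion ℚ))
  have hle := fun n ↦ localLayerPointsOfEmb_le_localTowerPointsOfEmb κ (closureEmb (K := ℚ) (v.adicCompletion ℚ)) W n
  have hc := hH.2.1
  have hTr := hH.2.2.2.2.1
  -- the LINE POINT at layer `2J + 2`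
  obtain ⟨x, hx, hdivK, ⟨w, hwM, hw⟩, hodd⟩ :=
    exists_linePoint κ (closureEmb (K := ℚ) (v.adicCompletion ℚ)) W ha hg hc hTr hnt J
  have hxT := hle _ hx
  -- a functional with `z₀(c_0)` odd: `c₋, g·c₁` are independent mod `2` and `c_0 = (a² − 2a − 1)c₋` with `a` even
  obtain ⟨H, hHle, hfinH, hφ⟩ := silvermanVII63_localLayerPoints_finiteIndex_zpLattice.rat
    silvermanVII63_localLayerPoints_finiteIndex_zpLattice_holds κ hv' (closureEmb (K := ℚ) (v.adicCompletion ℚ)) W 1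
  rw [index_localLayerSubgroupOfEmb_eq_pow_of_isTopGenerator κ (closureEmb (K := ℚ) (v.adicCompletion ℚ)) hg 1, pow_one] at hφ
  obtain ⟨φ⟩ := hφ
  have hind := independent_of_nondegeneratePair hnt hss.2 hg hH (exists_nondegeneratePair_of_lattice hHle hfinH φ)
  have hN : ∀ y : ↥(localTowerPointsOfEmb κ (closureEmb (K := ℚ) (v.adicCompletion ℚ)) W), 2 • y = 0 → y = 0 := fun y hy ↦
    Subtype.ext (hnt _ y.2 (by rw [← AddSubgroupClass.coe_nsmul, hy]; rfl))
  have hc0 : ∀ y : ↥(localTowerPointsOfEmb κ (closureEmb (K := ℚ) (v.adicCompletion ℚ)) W), 2 • y ≠ ⟨c 0, hle 0 (hc 0)⟩ := by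
    intro y hy
    have h2 : 2 • (y : localPoints W (v.adicCompletion ℚ)) =
        (W.frobeniusTrace 2 ^ 2 - 2 * W.frobeniusTrace 2 - 1) • cneg + (0 : ℤ) • (g • c 1) := by
      rw [zero_zsmul, add_zero, ← hH.2.2.1, ← AddSubgroupClass.coe_nsmul, hy]
    obtain ⟨h1, -⟩ := hind _ _ _ y.2 h2
    obtain ⟨b, hb⟩ := ha
    rw [hb] at h1
    have : (2 : ℤ) ∣ (2 * b) ^ 2 - 2 * (2 * b) - 1 - 2 * (2 * b ^ 2 - 2 * b - 1) := dvd_sub h1 (dvd_mul_right 2 _)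
    have e : (2 * b) ^ 2 - 2 * (2 * b) - 1 - 2 * (2 * b ^ 2 - 2 * b - 1) = 1 := by ring
    rw [e] at this
    exact absurd this (by norm_num)
  obtain ⟨z₀, hz₀⟩ := Literature.Algebra.Module.exists_addMonoidHom_padicInt_not_dvd hN (k := 1)
    (fun y hy ↦ hc0 y (by rw [pow_one] at hy; exact hy))
  rw [pow_one] at hz₀
  obtain ⟨Ls, Lf, hz₀C⟩ := SSFlatEC.exists_isColemanPair_of_trace κ (closureEmb (K := ℚ) (v.adicCompletion ℚ)) W hg ha' hc hTr z₀
  have hprim : ∃ z : ↥(localTowerPointsOfEmb κ (closureEmb (K := ℚ) (v.adicCompletion ℚ)) W) →+ ℤ_[2],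
      ¬ (2 : ℤ_[2]) ∣ z ⟨x, hxT⟩ := ⟨z₀, hodd z₀ Ls Lf hz₀C hz₀⟩
  -- weaken the exponent `J + 2` to `J`
  have hdiv : ∀ z ∈ colemanKer κ (closureEmb (K := ℚ) (v.adicCompletion ℚ)) W (W.frobeniusTrace 2) g c .flat,
      (2 : ℤ_[2]) ^ J ∣ z ⟨x, hxT⟩ := fun z hz ↦ (pow_dvd_pow 2 (Nat.le_add_right J 2)).trans (hdivK z hz)
  have hanti : ∃ w' ∈ localTowerPointsOfEmb κ (closureEmb (K := ℚ) (v.adicCompletion ℚ)) W, 2 ^ J • w' = g⁻¹ • x + x :=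
    ⟨2 ^ 2 • w, AddSubgroup.nsmul_mem _ hwM _, by rw [← hw, ← mul_smul, ← pow_add]⟩
  -- the local `ℤ₂`-extension with generator `g` and the finiteness of `H¹(ℚ_v, E[2^J](ψ₂))`
  obtain ⟨κE, hker, hgen⟩ := SSFlatEC.exists_localZpExtension_of_isTopGenerator κ (v.adicCompletion ℚ) (g := g) hg
  have hL : ∀ σ : absoluteGaloisGroup (v.adicCompletion ℚ), σ ∈ localSubgroup κ.kerSubgroup (v.adicCompletion ℚ) ↔
      κE.toContinuousMonoidHom σ = 1 := fun σ ↦ by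
    rw [← hker, ZpExtension.mem_kerSubgroup]; rfl
  haveI : NeZero (2 ^ J) := ⟨pow_ne_zero _ two_ne_zero⟩
  haveI : Finite (W.geomTorsion (((2 ^ J : ℕ)) : ℤ)) := finite_geomTorsion_of_neZero W (2 ^ J)
  have hfin : Finite (galoisCohomology ((W.twistedTorsionGaloisModule 2 κ J (-1) OddBlindTwist.two_dvd_neg_one_sub_one).restrictField
      (v.adicCompletion ℚ)) 1) :=
    finite_galoisCohomology_one_adicCompletion v _
  rw [twistedSharpFlatLocalFamily_self]
  exact pow_le_natCard_twistedSharpFlatLocalKummer_of_point W κ J OddBlindTwist.two_dvd_neg_one_sub_one (v.adicCompletion ℚ) hnt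
    κE.toContinuousMonoidHom hL hgen hg _ hxT hdiv hanti hprim hfin

/-- ★★★ **HAND h9 = HT-C7locE = (hE), VERBATIM** (the hypothesis `hE` of `lineComplement_of_transversal_of_lineCard`, ★★ p816496
`…FlatBlindCardPositionLocal.lean` :112–139), with `J₃ := 0`: for `W/ℚ` globally minimal with `GoodSS W 2`, `κ` cyclotomic, `v ∋ 2`, local data
`(g, c)` with the Honda-system hypotheses, and EVERY `J`: (T) the ♭-LINE `L^E_J` meets the twisted Kummer classes of the layer-`1` points
killed by `g + 1` only in `0`, and (C) `2^J ≤ #L^E_J`.  Conjunct (T) is ★★ p818772 `HTC7locE_flatLine_inf_layerOneKummer_eq_bot`, conjunct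
(C) is `HTC7locE_lineCard`.  A helper for crux 19097 (slot 5 CDC_H via the glue chain); nothing is booked; BSD is proved for no curve.
[cite: Kobayashi2003, §8 Prop. 8.12] [cite: Sprung2012, Thm. 2.2, Def. 5.9, Def. 7.9 and Def. 7.11] [cite: GreenbergLNM1716, §3–§4]
[cite: MilneADT2006, I Cor. 2.3] [cite: SilvermanAEC2009, VII Prop. 6.3] -/
theorem HTC7locE_flatLine_transversal_and_card :
    ∀ (W : WeierstrassCurve ℚ) [W.IsElliptic] [W.IsGloballyMinimal], GoodSS W 2 →
      ∀ (κ : ZpExtension ℚ 2), κ.IsCyclotomic →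
      ∀ (v : HeightOneSpectrum (𝓞 ℚ)), (2 : 𝓞 ℚ) ∈ v.asIdeal →
      ∀ (g : Field.absoluteGaloisGroup (v.adicCompletion ℚ)) (c : ℕ → localPoints W (v.adicCompletion ℚ)),
        κ.IsTopGenerator (resGalOfEmb (closureEmb (K := ℚ) (v.adicCompletion ℚ)) g) →
        (∀ n, c n ∈ localLayerPointsOfEmb κ (closureEmb (K := ℚ) (v.adicCompletion ℚ)) W n) →
        (∀ n, 1 ≤ n → localTraceOfEmb κ (closureEmb (K := ℚ) (v.adicCompletion ℚ)) W n (n + 1)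
          (c (n + 1)) = W.frobeniusTrace 2 • c n - c (n - 1)) →
        (∀ z₀ : localLayerPointsOfEmb κ (closureEmb (K := ℚ) (v.adicCompletion ℚ)) W 0 →+ ℤ_[2],
          evalOn W (localLayerPointsOfEmb κ (closureEmb (K := ℚ) (v.adicCompletion ℚ)) W 0) z₀ (c 0) = 0 → z₀ = 0) →
        (∀ a : ℤ_[2],
          (∃ z₀ : localLayerPointsOfEmb κ (closureEmb (K := ℚ) (v.adicCompletion ℚ)) W 0 →+ ℤ_[2],
            evalOn W (localLayerPointsOfEmb κ (closureEmb (K := ℚ) (v.adicCompletion ℚ)) W 0) z₀ (c 0) = 2 * a) →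
          ∃ y : localLayerPointsOfEmb κ (closureEmb (K := ℚ) (v.adicCompletion ℚ)) W 0 →+ ℤ_[2],
            evalOn W (localLayerPointsOfEmb κ (closureEmb (K := ℚ) (v.adicCompletion ℚ)) W 0) y (c 0) = a) →
        (∃ cneg : localPoints W (v.adicCompletion ℚ),
          Summit.BirchSwinnertonDyer.Rank1Residual.F1Sign2.IsHondaSystemAtTwo κ (closureEmb (K := ℚ) (v.adicCompletion ℚ)) W
            (W.frobeniusTrace 2) g cneg c) →
      ∃ J₃ : ℕ, ∀ J : ℕ, J₃ ≤ J →
        W.twistedSharpFlatLocalFamily 2 κ J (-1) OddBlindTwist.two_dvd_neg_one_sub_one v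
            (localTowerPointsOfEmb κ (closureEmb (K := ℚ) (v.adicCompletion ℚ)) W)
            (colemanKer κ (closureEmb (K := ℚ) (v.adicCompletion ℚ)) W (W.frobeniusTrace 2) g c .flat) v ⊓
          W.twistedTorsionLocalKummer 2 κ J (-1) OddBlindTwist.two_dvd_neg_one_sub_one (v.adicCompletion ℚ)
            (localLayerPointsOfEmb κ (closureEmb (K := ℚ) (v.adicCompletion ℚ)) W 1 ⊓
              (DistribSMul.toAddMonoidHom (localPoints W (v.adicCompletion ℚ)) g + AddMonoidHom.id _).ker) = ⊥ ∧
        2 ^ J ≤ Nat.card (W.twistedSharpFlatLocalFamily 2 κ J (-1) OddBlindTwist.two_dvd_neg_one_sub_one v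
            (localTowerPointsOfEmb κ (closureEmb (K := ℚ) (v.adicCompletion ℚ)) W)
            (colemanKer κ (closureEmb (K := ℚ) (v.adicCompletion ℚ)) W (W.frobeniusTrace 2) g c .flat) v) := by
  intro W _ _ hss κ hκ v hv g c hg hc htr hz hsat hH
  exact ⟨0, fun J _ ↦ ⟨HTC7locE_flatLine_inf_layerOneKummer_eq_bot W hss κ hκ v hv g c hg hc htr hz hsat hH J,
    HTC7locE_lineCard W hss κ hκ v hv g c hg hc htr hz hsat hH J⟩⟩

end OddBlindLocal

end Summit.BirchSwinnertonDyer.BirchSwinnertonDyer.Theorems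

end
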